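import Literature.NumberTheory.Rogawski1990.TransferFactorConstMul              -- `TransferFactorData.constMul` (B1, definition half)
import Literature.NumberTheory.Rogawski1990.CharIdentityOnTestFunctionsSigned   -- ★ `CMNonsplitCharIdentityAtTestSigned`, `CMCharIdentityClausesTestSigned`, `…PackageTestSigned` (+ the unsigned ★ defs)
import Literature.NumberTheory.Rogawski1990.LocalTransferExistence              -- ★ `IsDeltaTransferExistsRel`, `IsLocalDeltaTransferExists`
import Literature.NumberTheory.Rogawski1990.LocalTransferLinear                 -- ★ `stableOrbitalIntegralRel_smul_fun` (via `LocalStableOrbitalFinite`)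
import Literature.NumberTheory.Rogawski1990.RankOneEulerPoincareGlue             -- ★ `IsLocSmooth.const_smul`
import HarnessLib

/-!
# Moving a sign between the transfer factor and the member traces: `(f^H, f)` is `(ε·Δ)`-matched iff `(ε·f^H, f)` is `Δ`-matched, so the UNSIGNED identity
# (13.1.4) at `ε·Δ` is the SIGNED identity at `Δ` (Rogawski (1990) §4.3 (4.3.1) p. 43, §4.9 p. 55, §13.1 Prop. 13.1.4 p. 199, §14.6 p. 242; Langlands–Shelstad (1987) §1)

Topic `NumberTheory/Rogawski1990`; namespace `Literature.NumberTheory.Rogawski1990`.  THEOREMS ONLY (no definition, no instance, no notation, no named fact, no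
`sorry`).  Cell `pub/hodgecm-mathlib` (D-0151), crux H413 = `stmt-HodgeConjecture-24833`; organ **B1 «SIGN-RESCALE»** of referee F0P2-ref1 (g10) objection ⑧ r353, dealt by
LEAD F0P3a-plan (g13) T12-14 (4) to F0P2-p06 (g14).  HONEST LABEL: HC_CM is proved only modulo the printed citations (2 remaining named inputs hLiu418, h413) until rung 0
closes; this file proves no printed statement — it is currency plumbing between the tree's transfer factor of record `Δ‴_v` and print's `Δ°_v = ε_v(H) · Δ‴_v`.

THE POINT.  The character identity (13.1.4) is stated in the tree as ★ `LocalAPacket.CharIdentityAtTest` with the member traces `tr` a PARAMETER and the matching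
`IsLocalDeltaTransfer L H′ v Δ mH mG` = (4.3.1) `Φ^st_H(γ_H, f^H) = Σ_{[γ]} Δ(γ_H, γ) Φ([γ], f)`.  Both sides of (4.3.1) are LINEAR in the test functions (★
`stableOrbitalIntegralRel_smul_fun`, Mathlib `mul_finsum`), so for a constant `c ≠ 0` the pair `(c · f^H, f)` is `(c·Δ)`-matched iff `(f^H, f)` is `Δ`-matched, and for a
SIGN `ε` (`ε · ε = 1`) the pair `(f^H, f)` is `(ε·Δ)`-matched iff `(ε · f^H, f)` is `Δ`-matched.  Since `χ_ξ(ε · f^H) = ε · χ_ξ(f^H)` (★ `charDist_smul`) and `C_c^∞` is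
stable under scalars (★ `IsLocSmooth.const_smul`), the UNSIGNED identity `χ_ξ(f^H) = Σ χ_π(f)` for `(ε·Δ)`-matched test pairs is EQUIVALENT to the SIGNED identity
`χ_ξ(f^H) = ε · Σ χ_π(f)` for `Δ`-matched test pairs (★ `CharIdentityOnTestFunctionsSigned`: «a pair `(f^H, f)` matched by `Δ‴_v` is a pair `(ε_v f^H, f)` matched by
`Δ_v`»).  Consequently the closer's SIGNED exports at the factor of record `Δ‴` (★ `CMCharIdentityClausesTestSigned`, sign `ε_v(H) = ω_{L_w∕L⁺_v}(a)` of the frame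
multiplier) ARE the unsigned letters (★ `CMCharIdentityClausesTest`) at the rescaled family `Δ°_v := (Δ‴_v).constMul (ε v)` for ANY sign family `ε` that agrees with the
clause sign at every frame of every non-split `v` and equals `1` at split `v` — the form sign `formSignAt` of LH7 (frame-independence «`a ≡ −det H` mod norms») is such a
family; this file is generic in `ε` and does not choose it.

* §0 `TransferFactorData.ext_of_Δ`, `constMul_one`, `constMul_constMul`, `constMul_constMul_self_of_mul_self_eq_one` (a sign rescaling is an involution), `constMul_zero_eq_zero`.
* §1 (abstract groups) `LocalAPacket.traceSum_const_mul`; **`isDeltaTransferRel_constMul_smul_iff`** (`c ≠ 0`: `(c·f^H, f)` is `(c·Δ)`-matched iff `(f^H, f)` is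
  `Δ`-matched); **`isDeltaTransferRel_constMul_iff_smul`** (`ε·ε = 1`); `isDeltaTransferExistsRel_constMul_iff` (existence of transfers is scale-invariant on a
  scalar-stable `H`-side class); **`LocalAPacket.charIdentityOn_iff_mul_of_sign`** (the generic sign transport).
* §2 (CM-local, `G′_v = U(H′)(L⁺_v)`) `isLocalDeltaTransfer_constMul_smul_iff`, `isLocalDeltaTransfer_constMul_iff_smul`, **`isLocalDeltaTransferExists_constMul_iff`**
  (`IsLocSmooth` classes), **`LocalAPacket.charIdentityAtTest_constMul_iff`** (`P.CharIdentityAtTest tr ξ μH (Δ.constMul ε) mH mG ↔ P.CharIdentityAtTest (ε·tr) ξ μH Δ mH mG`),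
  **`cmNonsplitCharIdentityAtTest_constMul_iff_signed`** (`CMNonsplitCharIdentityAtTest … (Δ.constMul ε) … πⁿ ↔ CMNonsplitCharIdentityAtTestSigned … Δ … ε πⁿ`),
  `cmNonsplitCharIdentityAtTestSigned_constMul_iff`.
* §3 (the joint letter) **`cmCharIdentityClausesTest_constMul_iff_signed`** and **`cmCharIdentityPackageTest_constMul_iff_signed`**: for a sign family `ε` with
  `ε v = (clause sign of the frame)` at non-split `v` and `ε v = 1` at split `v`, `CMCharIdentityClausesTest … (fun v => (Δ v).constMul (ε v)) … ↔ CMCharIdentityClausesTestSigned … Δ …`.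

## References
* [Rogawski1990] J. D. Rogawski, *Automorphic Representations of Unitary Groups in Three Variables*, Ann. of Math. Stud. 123 (1990): §4.3 (4.3.1) p. 43; §4.9 Prop. 4.9.1
  (a) p. 55; §13.1 Prop. 13.1.3 (d), Prop. 13.1.4 p. 199; §14.6 p. 242.
* [LanglandsShelstad1987] R. P. Langlands, D. Shelstad, *On the definition of transfer factors*, Math. Ann. 278 (1987): §1.
-/

set_option autoImplicit false

noncomputable section

open MeasureTheory NumberField IsDedekindDomain Topology
open scoped Matrix MatrixGroups ComplexOrder

namespace Literature.NumberTheory.Rogawski1990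

open Literature.NumberTheory.Automorphic Literature.NumberTheory.Automorphic.UnitaryGroup
open Literature.NumberTheory.Automorphic.UnitaryGroup.CotangentForms Literature.NumberTheory.GaloisRepresentations
open Literature.NumberTheory.Automorphic.Arthur2013.Leaves.TECR

/-! ## §0 Algebra of `TransferFactorData.constMul` -/

section ConstMul

variable {A B : Type*} [Group A] [Group B] {R : A → B → Prop}

/-- Two transfer factors for the same relation with the same values are equal (the other fields are proofs). [cite: Rogawski1990, §4.3 p. 43] -/
theorem TransferFactorData.ext_of_Δ {T T' : TransferFactorData A B R} (h : T.Δ = T'.Δ) : T = T' := by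
  cases T; cases T'; cases h; rfl

/-- `Δ.constMul 1 = Δ`. [cite: Rogawski1990, §4.3 p. 43] -/
theorem TransferFactorData.constMul_one (T : TransferFactorData A B R) : T.constMul 1 = T :=
  TransferFactorData.ext_of_Δ (funext fun a => funext fun b => by rw [TransferFactorData.constMul_Δ, one_mul])

/-- `(Δ.constMul c).constMul c′ = Δ.constMul (c′ · c)`. [cite: Rogawski1990, §4.3 p. 43] -/
theorem TransferFactorData.constMul_constMul (T : TransferFactorData A B R) (c c' : ℂ) :
    (T.constMul c).constMul c' = T.constMul (c' * c) :=
  TransferFactorData.ext_of_Δ (funext fun a => funext fun b => by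
    rw [TransferFactorData.constMul_Δ, TransferFactorData.constMul_Δ, TransferFactorData.constMul_Δ, mul_assoc])

/-- For a sign `ε` (`ε · ε = 1`), rescaling twice is the identity: `(Δ.constMul ε).constMul ε = Δ` — so `Δ‴ = Δ°.constMul ε` as well as `Δ° = Δ‴.constMul ε`.
[cite: Rogawski1990, §14.6 p. 242] -/
theorem TransferFactorData.constMul_constMul_self_of_mul_self_eq_one (T : TransferFactorData A B R) {ε : ℂ} (hε : ε * ε = 1) :
    (T.constMul ε).constMul ε = T := by
  rw [TransferFactorData.constMul_constMul, hε, TransferFactorData.constMul_one]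

/-- Rescaling the ZERO factor gives the zero factor. [cite: Rogawski1990, §4.3 p. 43] -/
theorem TransferFactorData.constMul_zero_eq_zero (c : ℂ) :
    (TransferFactorData.zero A B R).constMul c = TransferFactorData.zero A B R :=
  TransferFactorData.ext_of_Δ (funext fun a => funext fun b => by
    rw [TransferFactorData.constMul_Δ, TransferFactorData.zero_Δ, mul_zero])

end ConstMul

/-! ## §1 Abstract groups: (4.3.1) and the identity under a constant rescaling of `Δ` -/

section Abstract

/-- `Σ_{π ∈ Π} ε · χ_π(f) = ε · Σ_{π ∈ Π} χ_π(f)` (the trace sum is linear in the member-trace parameter). [cite: Rogawski1990, §13.1 Prop. 13.1.4 p. 199] -/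
theorem LocalAPacket.traceSum_const_mul {C TG : Type*} (P : LocalAPacket C) (tr : C → TG → ℂ) (ε : ℂ) (f : TG) :
    P.traceSum (fun c g => ε * tr c g) f = ε * P.traceSum tr f := by
  rcases h : P.πs with _ | c
  · rw [P.traceSum_of_πs_eq_none _ _ h, P.traceSum_of_πs_eq_none _ _ h]
  · rw [P.traceSum_of_πs_eq_some _ _ h, P.traceSum_of_πs_eq_some _ _ h, mul_add]

variable {A B : Type*} [Group A] [Group B]
  [∀ a : A, MeasurableSpace (A ⧸ Subgroup.centralizer ({a} : Set A))]
  [∀ b : B, MeasurableSpace (B ⧸ Subgroup.centralizer ({b} : Set B))]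

/-- **(4.3.1) under a constant rescaling of `Δ`, `c ≠ 0`**: `(c · f^H, f)` is `(c·Δ)`-matched iff `(f^H, f)` is `Δ`-matched (both sides of (4.3.1) acquire the factor
`c`: ★ `stableOrbitalIntegralRel_smul_fun`, Mathlib `mul_finsum`). [cite: Rogawski1990, §4.3 (4.3.1) p. 43] -/
theorem isDeltaTransferRel_constMul_smul_iff {R : A → B → Prop} {stA : A → A → Prop} {regA : A → Prop} (T : TransferFactorData A B R)
    (mH : OrbitalMeasureFamily A) (mG : OrbitalMeasureFamily B) {c : ℂ} (hc : c ≠ 0) (fH : A → ℂ) (f : B → ℂ) :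
    IsDeltaTransferRel R stA regA (T.constMul c) mH mG (c • fH) f ↔ IsDeltaTransferRel R stA regA T mH mG fH f := by
  refine forall_congr' fun a => forall_congr' fun _ => ?_
  rw [stableOrbitalIntegralRel_smul_fun]
  simp only [TransferFactorData.constMul_Δ, mul_assoc]
  rw [← mul_finsum]
  exact mul_right_inj' hc

/-- **(4.3.1) under a SIGN `ε` (`ε · ε = 1`)**: `(f^H, f)` is `(ε·Δ)`-matched iff `(ε · f^H, f)` is `Δ`-matched — «a pair matched by `Δ‴_v = ε_v · Δ_v` is a pair
`(ε_v f^H, f)` matched by `Δ_v`». [cite: Rogawski1990, §4.3 (4.3.1) p. 43; §14.6 p. 242] -/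
theorem isDeltaTransferRel_constMul_iff_smul {R : A → B → Prop} {stA : A → A → Prop} {regA : A → Prop} (T : TransferFactorData A B R)
    (mH : OrbitalMeasureFamily A) (mG : OrbitalMeasureFamily B) {ε : ℂ} (hε : ε * ε = 1) (fH : A → ℂ) (f : B → ℂ) :
    IsDeltaTransferRel R stA regA (T.constMul ε) mH mG fH f ↔ IsDeltaTransferRel R stA regA T mH mG (ε • fH) f := by
  have hε0 : ε ≠ 0 := fun h => zero_ne_one (by rw [← hε, h, mul_zero])
  have hfH : fH = ε • (ε • fH) := by rw [smul_smul, hε, one_smul]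
  conv_lhs => rw [hfH]
  exact isDeltaTransferRel_constMul_smul_iff T mH mG hε0 (ε • fH) f

/-- **Existence of transfers [Prop. 4.9.1 (a)] is invariant under a constant rescaling of `Δ`** (`c ≠ 0`), for an `H`-side class `SmoothH` stable under scalars:
`f ↦ c · f^H` resp. `f ↦ c⁻¹ · f^H`. [cite: Rogawski1990, §4.9 Prop. 4.9.1 (a) p. 55] -/
theorem isDeltaTransferExistsRel_constMul_iff {R : A → B → Prop} {stA : A → A → Prop} {regA : A → Prop} (T : TransferFactorData A B R)
    (mH : OrbitalMeasureFamily A) (mG : OrbitalMeasureFamily B) (SmoothG : (B → ℂ) → Prop) (SmoothH : (A → ℂ) → Prop)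
    (hSH : ∀ (z : ℂ) (fH : A → ℂ), SmoothH fH → SmoothH (z • fH)) {c : ℂ} (hc : c ≠ 0) :
    IsDeltaTransferExistsRel R stA regA (T.constMul c) mH mG SmoothG SmoothH ↔ IsDeltaTransferExistsRel R stA regA T mH mG SmoothG SmoothH := by
  refine ⟨fun h f hf => ?_, fun h f hf => ?_⟩
  · obtain ⟨fH, hH, htr⟩ := h f hf
    refine ⟨c⁻¹ • fH, hSH _ _ hH, ?_⟩
    rw [← isDeltaTransferRel_constMul_smul_iff T mH mG hc, smul_smul, mul_inv_cancel₀ hc, one_smul]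
    exact htr
  · obtain ⟨fH, hH, htr⟩ := h f hf
    exact ⟨c • fH, hSH _ _ hH, (isDeltaTransferRel_constMul_smul_iff T mH mG hc fH f).2 htr⟩

/-- **The generic sign transport for the identity on test classes.**  If `Match′ f^H f ↔ Match (ε · f^H) f`, `trξ(ε · f^H) = ε · trξ(f^H)`, the `H`-side test class is
stable under `ε ·`, and `ε · ε = 1`, then `χ_ξ(f^H) = Σ χ_π(f)` on `Match′`-pairs iff `χ_ξ(f^H) = ε · Σ χ_π(f)` on `Match`-pairs.
[cite: Rogawski1990, §13.1 Prop. 13.1.4 p. 199; §14.6 p. 242] -/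
theorem LocalAPacket.charIdentityOn_iff_mul_of_sign {C TG TH : Type*} [MulAction ℂ TH] (P : LocalAPacket C) (tr : C → TG → ℂ) (trξ : TH → ℂ)
    (Match Match' : TH → TG → Prop) (TestH : TH → Prop) (TestG : TG → Prop) {ε : ℂ} (hε : ε * ε = 1)
    (hM : ∀ fH f, Match' fH f ↔ Match (ε • fH) f) (htrξ : ∀ fH, trξ (ε • fH) = ε * trξ fH) (hT : ∀ fH, TestH fH → TestH (ε • fH)) :
    P.CharIdentityOn tr trξ Match' TestH TestG ↔ P.CharIdentityOn (fun c g => ε * tr c g) trξ Match TestH TestG := by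
  have hε0 : ε ≠ 0 := fun h => zero_ne_one (by rw [← hε, h, mul_zero])
  refine ⟨fun h fH f hH hG hm => ?_, fun h fH f hH hG hm' => ?_⟩
  · -- `(f^H, f)` is `Match`-matched, so `(ε · f^H, f)` is `Match′`-matched
    have hm' : Match' (ε • fH) f := (hM _ _).2 (by rwa [smul_smul, hε, one_smul])
    have h1 := h (ε • fH) f (hT _ hH) hG hm'
    rw [htrξ] at h1
    rw [P.traceSum_const_mul, ← h1, ← mul_assoc, hε, one_mul]
  · have h1 := h (ε • fH) f (hT _ hH) hG ((hM _ _).1 hm')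
    rw [htrξ, P.traceSum_const_mul] at h1
    exact mul_left_cancel₀ hε0 h1

end Abstract

/-! ## §2 The CM-local dress: `G′_v = U(H′)(L⁺_v)`, `H_v = U(Φ₂)(L⁺_v) × U(Φ₁)(L⁺_v)` -/

section CMAt

variable (L : Type) [Field L] [NumberField L] [IsCMField L] (H' : Matrix (Fin 3) (Fin 3) L)
  (v : HeightOneSpectrum (𝓞 ↥(maximalRealSubfield L)))

variable
    {iH : ∀ a : ((UnitaryGroup.cmDatum L 2 (Matrix.of fun i j : Fin 2 => if i.val + j.val + 1 = 2 then (1 : L) else 0)).Local v ×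
        (UnitaryGroup.cmDatum L 1 (Matrix.of fun i j : Fin 1 => if i.val + j.val + 1 = 1 then (1 : L) else 0)).Local v),
      MeasurableSpace (((UnitaryGroup.cmDatum L 2 (Matrix.of fun i j : Fin 2 => if i.val + j.val + 1 = 2 then (1 : L) else 0)).Local v ×
        (UnitaryGroup.cmDatum L 1 (Matrix.of fun i j : Fin 1 => if i.val + j.val + 1 = 1 then (1 : L) else 0)).Local v) ⧸
        Subgroup.centralizer ({a} : Set ((UnitaryGroup.cmDatum L 2 (Matrix.of fun i j : Fin 2 => if i.val + j.val + 1 = 2 then (1 : L) else 0)).Local v ×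
        (UnitaryGroup.cmDatum L 1 (Matrix.of fun i j : Fin 1 => if i.val + j.val + 1 = 1 then (1 : L) else 0)).Local v)))}
    {iG : ∀ γ : (UnitaryGroup.cmDatum L 3 H').Local v,
      MeasurableSpace ((UnitaryGroup.cmDatum L 3 H').Local v ⧸ Subgroup.centralizer ({γ} : Set ((UnitaryGroup.cmDatum L 3 H').Local v)))}

/-- **(4.9.1) under a constant rescaling of `Δ_v`, `c ≠ 0`**: `(c · f^H_v, f_v)` is `(c·Δ_v)`-matched iff `(f^H_v, f_v)` is `Δ_v`-matched. [cite: Rogawski1990, §4.9 (4.9.1) p. 55] -/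
theorem isLocalDeltaTransfer_constMul_smul_iff (T : LocalTransferFactor L H' v)
    (mH : OrbitalMeasureFamily ((UnitaryGroup.cmDatum L 2 (Matrix.of fun i j : Fin 2 => if i.val + j.val + 1 = 2 then (1 : L) else 0)).Local v ×
        (UnitaryGroup.cmDatum L 1 (Matrix.of fun i j : Fin 1 => if i.val + j.val + 1 = 1 then (1 : L) else 0)).Local v))
    (mG : OrbitalMeasureFamily ((UnitaryGroup.cmDatum L 3 H').Local v)) {c : ℂ} (hc : c ≠ 0)
    (fH : ((UnitaryGroup.cmDatum L 2 (Matrix.of fun i j : Fin 2 => if i.val + j.val + 1 = 2 then (1 : L) else 0)).Local v ×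
        (UnitaryGroup.cmDatum L 1 (Matrix.of fun i j : Fin 1 => if i.val + j.val + 1 = 1 then (1 : L) else 0)).Local v) → ℂ)
    (f : (UnitaryGroup.cmDatum L 3 H').Local v → ℂ) :
    IsLocalDeltaTransfer L H' v (_ha := iH) (_hγ := iG) (T.constMul c) mH mG (c • fH) f ↔ IsLocalDeltaTransfer L H' v (_ha := iH) (_hγ := iG) T mH mG fH f :=
  isDeltaTransferRel_constMul_smul_iff T mH mG hc fH f

/-- **(4.9.1) under a SIGN** (`ε · ε = 1`): `(f^H_v, f_v)` is `(ε·Δ_v)`-matched iff `(ε · f^H_v, f_v)` is `Δ_v`-matched. [cite: Rogawski1990, §4.9 (4.9.1) p. 55; §14.6 p. 242] -/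
theorem isLocalDeltaTransfer_constMul_iff_smul (T : LocalTransferFactor L H' v)
    (mH : OrbitalMeasureFamily ((UnitaryGroup.cmDatum L 2 (Matrix.of fun i j : Fin 2 => if i.val + j.val + 1 = 2 then (1 : L) else 0)).Local v ×
        (UnitaryGroup.cmDatum L 1 (Matrix.of fun i j : Fin 1 => if i.val + j.val + 1 = 1 then (1 : L) else 0)).Local v))
    (mG : OrbitalMeasureFamily ((UnitaryGroup.cmDatum L 3 H').Local v)) {ε : ℂ} (hε : ε * ε = 1)
    (fH : ((UnitaryGroup.cmDatum L 2 (Matrix.of fun i j : Fin 2 => if i.val + j.val + 1 = 2 then (1 : L) else 0)).Local v ×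
        (UnitaryGroup.cmDatum L 1 (Matrix.of fun i j : Fin 1 => if i.val + j.val + 1 = 1 then (1 : L) else 0)).Local v) → ℂ)
    (f : (UnitaryGroup.cmDatum L 3 H').Local v → ℂ) :
    IsLocalDeltaTransfer L H' v (_ha := iH) (_hγ := iG) (T.constMul ε) mH mG fH f ↔ IsLocalDeltaTransfer L H' v (_ha := iH) (_hγ := iG) T mH mG (ε • fH) f :=
  isDeltaTransferRel_constMul_iff_smul T mH mG hε fH f

/-- **Existence of the local transfer on `C_c^∞` [Prop. 4.9.1 (a)] is invariant under a constant rescaling of `Δ_v`** (`c ≠ 0`; `C_c^∞` = ★ `IsLocSmooth` is stable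
under scalars, ★ `IsLocSmooth.const_smul`) — the (H₇) currency at `Δ°_v` from the one at `Δ‴_v`. [cite: Rogawski1990, §4.9 Prop. 4.9.1 (a) p. 55] -/
theorem isLocalDeltaTransferExists_constMul_iff (T : LocalTransferFactor L H' v)
    (mH : OrbitalMeasureFamily ((UnitaryGroup.cmDatum L 2 (Matrix.of fun i j : Fin 2 => if i.val + j.val + 1 = 2 then (1 : L) else 0)).Local v ×
        (UnitaryGroup.cmDatum L 1 (Matrix.of fun i j : Fin 1 => if i.val + j.val + 1 = 1 then (1 : L) else 0)).Local v))
    (mG : OrbitalMeasureFamily ((UnitaryGroup.cmDatum L 3 H').Local v)) {c : ℂ} (hc : c ≠ 0) :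
    IsLocalDeltaTransferExists L H' v (_ha := iH) (_hγ := iG) (T.constMul c) mH mG IsLocSmooth IsLocSmooth ↔
      IsLocalDeltaTransferExists L H' v (_ha := iH) (_hγ := iG) T mH mG IsLocSmooth IsLocSmooth :=
  isDeltaTransferExistsRel_constMul_iff T mH mG IsLocSmooth IsLocSmooth (fun z _ h => h.const_smul z) hc

variable {_hm : MeasurableSpace ((UnitaryGroup.cmDatum L 2 (Matrix.of fun i j : Fin 2 => if i.val + j.val + 1 = 2 then (1 : L) else 0)).Local v ×
      (UnitaryGroup.cmDatum L 1 (Matrix.of fun i j : Fin 1 => if i.val + j.val + 1 = 1 then (1 : L) else 0)).Local v)}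

/-- **THE SIGN TRANSPORT FOR (13.1.4) ON TEST FUNCTIONS**: for a sign `ε` (`ε · ε = 1`), the UNSIGNED identity at the rescaled factor `Δ_v.constMul ε` is the SIGNED
identity (member traces `ε · tr`) at `Δ_v`: `P.CharIdentityAtTest tr ξ μH (Δ.constMul ε) mH mG ↔ P.CharIdentityAtTest (fun c f => ε · tr c f) ξ μH Δ mH mG`
(§1 `charIdentityOn_iff_mul_of_sign` with ★ `charDist_smul`, ★ `IsLocSmooth.const_smul`, `isLocalDeltaTransfer_constMul_iff_smul`).
[cite: Rogawski1990, §13.1 Prop. 13.1.4 p. 199; §14.6 p. 242] [cite: LanglandsShelstad1987, §1] -/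
theorem LocalAPacket.charIdentityAtTest_constMul_iff (P : CMLocalAPacket L H' v)
    (tr : IrrClass ((UnitaryGroup.cmDatum L 3 H').Local v) → ((UnitaryGroup.cmDatum L 3 H').Local v → ℂ) → ℂ)
    (ξ : (UnitaryGroup.cmDatum L 2 (Matrix.of fun i j : Fin 2 => if i.val + j.val + 1 = 2 then (1 : L) else 0)).Local v ×
        (UnitaryGroup.cmDatum L 1 (Matrix.of fun i j : Fin 1 => if i.val + j.val + 1 = 1 then (1 : L) else 0)).Local v →* ℂˣ)
    (μH : Measure ((UnitaryGroup.cmDatum L 2 (Matrix.of fun i j : Fin 2 => if i.val + j.val + 1 = 2 then (1 : L) else 0)).Local v ×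
        (UnitaryGroup.cmDatum L 1 (Matrix.of fun i j : Fin 1 => if i.val + j.val + 1 = 1 then (1 : L) else 0)).Local v))
    (T : LocalTransferFactor L H' v)
    (mH : OrbitalMeasureFamily ((UnitaryGroup.cmDatum L 2 (Matrix.of fun i j : Fin 2 => if i.val + j.val + 1 = 2 then (1 : L) else 0)).Local v ×
        (UnitaryGroup.cmDatum L 1 (Matrix.of fun i j : Fin 1 => if i.val + j.val + 1 = 1 then (1 : L) else 0)).Local v))
    (mG : OrbitalMeasureFamily ((UnitaryGroup.cmDatum L 3 H').Local v)) {ε : ℂ} (hε : ε * ε = 1) :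
    P.CharIdentityAtTest L H' v (_hm := _hm) (_ha := iH) (_hγ := iG) tr ξ μH (T.constMul ε) mH mG ↔
      P.CharIdentityAtTest L H' v (_hm := _hm) (_ha := iH) (_hγ := iG) (fun c f => ε * tr c f) ξ μH T mH mG :=
  LocalAPacket.charIdentityOn_iff_mul_of_sign P tr (charDist ξ μH)
    (fun fH f => IsLocalDeltaTransfer L H' v (_ha := iH) (_hγ := iG) T mH mG fH f)
    (fun fH f => IsLocalDeltaTransfer L H' v (_ha := iH) (_hγ := iG) (T.constMul ε) mH mG fH f) IsLocSmooth IsLocSmooth hε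
    (fun fH f => isLocalDeltaTransfer_constMul_iff_smul L H' v T mH mG hε fH f) (fun fH => charDist_smul ξ μH ε fH)
    (fun _ h => h.const_smul ε)

end CMAt

/-! ### §2b The non-split letter [13.1.4]: unsigned at `Δ_v.constMul ε` = signed at `Δ_v` -/

section CM

variable (L : Type) [Field L] [NumberField L] [IsCMField L]
  (v : HeightOneSpectrum (𝓞 ↥(maximalRealSubfield L))) (H' : Matrix (Fin 3) (Fin 3) L)

variable
    [MeasurableSpace ((UnitaryGroup.cmDatum L 3 H').Local v)]
    [MeasurableSpace ((UnitaryGroup.cmDatum L 2 (Matrix.of fun i j : Fin 2 => if i.val + j.val + 1 = 2 then (1 : L) else 0)).Local v ×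
      (UnitaryGroup.cmDatum L 1 (Matrix.of fun i j : Fin 1 => if i.val + j.val + 1 = 1 then (1 : L) else 0)).Local v)]
    [∀ a : ((UnitaryGroup.cmDatum L 2 (Matrix.of fun i j : Fin 2 => if i.val + j.val + 1 = 2 then (1 : L) else 0)).Local v ×
        (UnitaryGroup.cmDatum L 1 (Matrix.of fun i j : Fin 1 => if i.val + j.val + 1 = 1 then (1 : L) else 0)).Local v),
      MeasurableSpace (((UnitaryGroup.cmDatum L 2 (Matrix.of fun i j : Fin 2 => if i.val + j.val + 1 = 2 then (1 : L) else 0)).Local v ×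
        (UnitaryGroup.cmDatum L 1 (Matrix.of fun i j : Fin 1 => if i.val + j.val + 1 = 1 then (1 : L) else 0)).Local v) ⧸
        Subgroup.centralizer ({a} : Set ((UnitaryGroup.cmDatum L 2 (Matrix.of fun i j : Fin 2 => if i.val + j.val + 1 = 2 then (1 : L) else 0)).Local v ×
        (UnitaryGroup.cmDatum L 1 (Matrix.of fun i j : Fin 1 => if i.val + j.val + 1 = 1 then (1 : L) else 0)).Local v)))]
    [∀ γ : (UnitaryGroup.cmDatum L 3 H').Local v,
      MeasurableSpace ((UnitaryGroup.cmDatum L 3 H').Local v ⧸ Subgroup.centralizer ({γ} : Set ((UnitaryGroup.cmDatum L 3 H').Local v)))]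

/-- **[13.1.4], non-split `v`: the UNSIGNED letter at `Δ_v.constMul ε` is the SIGNED letter at `Δ_v`** (`ε · ε = 1`):
`CMNonsplitCharIdentityAtTest … (Δ.constMul ε) … πⁿ ↔ CMNonsplitCharIdentityAtTestSigned … Δ … ε πⁿ` — same `πˢ`, same test classes.  Intended reading: `Δ = Δ‴_v` the
tree's factor of record, `ε = ε_v(H)`, `Δ‴_v.constMul ε = Δ°_v` print's factor transported by the frame.
[cite: Rogawski1990, §13.1 Prop. 13.1.3 (d), Prop. 13.1.4 p. 199; §14.6 p. 242] [cite: LanglandsShelstad1987, §1] -/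
theorem cmNonsplitCharIdentityAtTest_constMul_iff_signed
    (T : LocalTransferFactor L H' v)
    (mH : OrbitalMeasureFamily ((UnitaryGroup.cmDatum L 2 (Matrix.of fun i j : Fin 2 => if i.val + j.val + 1 = 2 then (1 : L) else 0)).Local v ×
        (UnitaryGroup.cmDatum L 1 (Matrix.of fun i j : Fin 1 => if i.val + j.val + 1 = 1 then (1 : L) else 0)).Local v))
    (mG : OrbitalMeasureFamily ((UnitaryGroup.cmDatum L 3 H').Local v)) (μG : Measure ((UnitaryGroup.cmDatum L 3 H').Local v))
    (μH : Measure ((UnitaryGroup.cmDatum L 2 (Matrix.of fun i j : Fin 2 => if i.val + j.val + 1 = 2 then (1 : L) else 0)).Local v ×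
        (UnitaryGroup.cmDatum L 1 (Matrix.of fun i j : Fin 1 => if i.val + j.val + 1 = 1 then (1 : L) else 0)).Local v))
    (ξv : (UnitaryGroup.cmDatum L 2 (Matrix.of fun i j : Fin 2 => if i.val + j.val + 1 = 2 then (1 : L) else 0)).Local v ×
        (UnitaryGroup.cmDatum L 1 (Matrix.of fun i j : Fin 1 => if i.val + j.val + 1 = 1 then (1 : L) else 0)).Local v →* ℂˣ)
    {ε : ℂ} (hε : ε * ε = 1) (πn : IrrClass ((UnitaryGroup.cmDatum L 3 H').Local v)) :
    CMNonsplitCharIdentityAtTest L v H' (T.constMul ε) mH mG μG μH ξv πn ↔ CMNonsplitCharIdentityAtTestSigned L v H' T mH mG μG μH ξv ε πn := by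
  refine exists_congr fun πs => and_congr_right fun _ => and_congr_right fun _ => ?_
  exact LocalAPacket.charIdentityAtTest_constMul_iff L H' v _ (fun c f => c.smoothTrace μG f) ξv μH T mH mG hε

/-- **Two signs compose**: the SIGNED letter with sign `ε′` at `Δ_v.constMul ε` is the SIGNED letter with sign `ε · ε′` at `Δ_v` (`ε · ε = 1`).
[cite: Rogawski1990, §13.1 Prop. 13.1.4 p. 199; §14.6 p. 242] -/
theorem cmNonsplitCharIdentityAtTestSigned_constMul_iff
    (T : LocalTransferFactor L H' v)
    (mH : OrbitalMeasureFamily ((UnitaryGroup.cmDatum L 2 (Matrix.of fun i j : Fin 2 => if i.val + j.val + 1 = 2 then (1 : L) else 0)).Local v ×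
        (UnitaryGroup.cmDatum L 1 (Matrix.of fun i j : Fin 1 => if i.val + j.val + 1 = 1 then (1 : L) else 0)).Local v))
    (mG : OrbitalMeasureFamily ((UnitaryGroup.cmDatum L 3 H').Local v)) (μG : Measure ((UnitaryGroup.cmDatum L 3 H').Local v))
    (μH : Measure ((UnitaryGroup.cmDatum L 2 (Matrix.of fun i j : Fin 2 => if i.val + j.val + 1 = 2 then (1 : L) else 0)).Local v ×
        (UnitaryGroup.cmDatum L 1 (Matrix.of fun i j : Fin 1 => if i.val + j.val + 1 = 1 then (1 : L) else 0)).Local v))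
    (ξv : (UnitaryGroup.cmDatum L 2 (Matrix.of fun i j : Fin 2 => if i.val + j.val + 1 = 2 then (1 : L) else 0)).Local v ×
        (UnitaryGroup.cmDatum L 1 (Matrix.of fun i j : Fin 1 => if i.val + j.val + 1 = 1 then (1 : L) else 0)).Local v →* ℂˣ)
    {ε : ℂ} (hε : ε * ε = 1) (ε' : ℂ) (πn : IrrClass ((UnitaryGroup.cmDatum L 3 H').Local v)) :
    CMNonsplitCharIdentityAtTestSigned L v H' (T.constMul ε) mH mG μG μH ξv ε' πn ↔
      CMNonsplitCharIdentityAtTestSigned L v H' T mH mG μG μH ξv (ε * ε') πn := by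
  refine exists_congr fun πs => and_congr_right fun _ => and_congr_right fun _ => ?_
  have hfun : (fun (c : IrrClass ((UnitaryGroup.cmDatum L 3 H').Local v)) (f : (UnitaryGroup.cmDatum L 3 H').Local v → ℂ) => ε * (ε' * c.smoothTrace μG f)) =
      fun c f => ε * ε' * c.smoothTrace μG f := by
    funext c f
    rw [mul_assoc]
  rw [LocalAPacket.charIdentityAtTest_constMul_iff L H' v _ (fun c f => ε' * c.smoothTrace μG f) ξv μH T mH mG hε, hfun]

end CM

/-! ## §3 The joint letter: the UNSIGNED clauses ∕ package at the rescaled family `v ↦ (Δ v).constMul (ε v)` = the SIGNED clauses ∕ package at `Δ` -/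

section Clauses

variable (L : Type) [Field L] [NumberField L] [IsCMField L] (H : Matrix (Fin 3) (Fin 3) L)
  (hH : (H.map (cmConjRingHom L))ᵀ = H) (hHd : IsUnit H.det)

variable
    [∀ v : HeightOneSpectrum (𝓞 ↥(maximalRealSubfield L)), MeasurableSpace ((cmDatum L 3 H).Local v)]
    [∀ v : HeightOneSpectrum (𝓞 ↥(maximalRealSubfield L)),
      MeasurableSpace ((cmDatum L 2 (Matrix.of fun i j : Fin 2 => if i.val + j.val + 1 = 2 then (1 : L) else 0)).Local v ×
        (cmDatum L 1 (Matrix.of fun i j : Fin 1 => if i.val + j.val + 1 = 1 then (1 : L) else 0)).Local v)]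
    [∀ (v : HeightOneSpectrum (𝓞 ↥(maximalRealSubfield L)))
        (a : ((cmDatum L 2 (Matrix.of fun i j : Fin 2 => if i.val + j.val + 1 = 2 then (1 : L) else 0)).Local v ×
          (cmDatum L 1 (Matrix.of fun i j : Fin 1 => if i.val + j.val + 1 = 1 then (1 : L) else 0)).Local v)),
      MeasurableSpace (((cmDatum L 2 (Matrix.of fun i j : Fin 2 => if i.val + j.val + 1 = 2 then (1 : L) else 0)).Local v ×
          (cmDatum L 1 (Matrix.of fun i j : Fin 1 => if i.val + j.val + 1 = 1 then (1 : L) else 0)).Local v) ⧸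
        Subgroup.centralizer ({a} : Set ((cmDatum L 2 (Matrix.of fun i j : Fin 2 => if i.val + j.val + 1 = 2 then (1 : L) else 0)).Local v ×
          (cmDatum L 1 (Matrix.of fun i j : Fin 1 => if i.val + j.val + 1 = 1 then (1 : L) else 0)).Local v)))]
    [∀ (v : HeightOneSpectrum (𝓞 ↥(maximalRealSubfield L))) (γ : (cmDatum L 3 H).Local v),
      MeasurableSpace ((cmDatum L 3 H).Local v ⧸ Subgroup.centralizer ({γ} : Set ((cmDatum L 3 H).Local v)))]

variable
  (Δ : ∀ v : HeightOneSpectrum (𝓞 ↥(maximalRealSubfield L)), LocalTransferFactor L H v)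
  (mH : ∀ v : HeightOneSpectrum (𝓞 ↥(maximalRealSubfield L)),
    OrbitalMeasureFamily ((cmDatum L 2 (Matrix.of fun i j : Fin 2 => if i.val + j.val + 1 = 2 then (1 : L) else 0)).Local v ×
      (cmDatum L 1 (Matrix.of fun i j : Fin 1 => if i.val + j.val + 1 = 1 then (1 : L) else 0)).Local v))
  (mG : ∀ v : HeightOneSpectrum (𝓞 ↥(maximalRealSubfield L)), OrbitalMeasureFamily ((cmDatum L 3 H).Local v))
  (νH : ∀ v : HeightOneSpectrum (𝓞 ↥(maximalRealSubfield L)),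
    Measure ((cmDatum L 2 (Matrix.of fun i j : Fin 2 => if i.val + j.val + 1 = 2 then (1 : L) else 0)).Local v ×
      (cmDatum L 1 (Matrix.of fun i j : Fin 1 => if i.val + j.val + 1 = 1 then (1 : L) else 0)).Local v))
  (νG : ∀ v : HeightOneSpectrum (𝓞 ↥(maximalRealSubfield L)), Measure ((cmDatum L 3 H).Local v))
  (μω : HeckeCharacter L) (hμu : μω.IsUnitary)

open scoped Classical in
/-- **THE UNSIGNED CLAUSES AT THE RESCALED FAMILY ARE THE SIGNED CLAUSES AT `Δ`.**  For a sign family `ε : v ↦ ℂ` that equals the clause sign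
`(if ∃ z, IsUnit z ∧ a = z · σ z then 1 else −1)` of EVERY frame `ᵗσT · H_v · T = a · Φ₃` at every non-split `v` (the frame-independent form sign `ε_v(H) = ω_{L_w∕L⁺_v}(−det H)`;
`a ≡ −det H` modulo norms) and equals `1` at every split `v`:
`CMCharIdentityClausesTest … (fun v => (Δ v).constMul (ε v)) … ↔ CMCharIdentityClausesTestSigned … Δ …` (non-split conjunct: §2b; split conjunct: `Δ_v.constMul 1 = Δ_v`).
[cite: Rogawski1990, §13.1 Prop. 13.1.3 (d), Prop. 13.1.4 p. 199; §14.6 p. 242; §13.3 p. 201] [cite: LanglandsShelstad1987, §1] -/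
theorem cmCharIdentityClausesTest_constMul_iff_signed (ξ : OneDimAutRepH L)
    (ξloc : ∀ v : HeightOneSpectrum (𝓞 ↥(maximalRealSubfield L)),
      (cmDatum L 2 (Matrix.of fun i j : Fin 2 => if i.val + j.val + 1 = 2 then (1 : L) else 0)).Local v ×
        (cmDatum L 1 (Matrix.of fun i j : Fin 1 => if i.val + j.val + 1 = 1 then (1 : L) else 0)).Local v →* ℂˣ)
    (ε : HeightOneSpectrum (𝓞 ↥(maximalRealSubfield L)) → ℂ)
    (hεn : ∀ v : HeightOneSpectrum (𝓞 ↥(maximalRealSubfield L)), (∀ w : PlacesOver L v, IsCMField.complexConj L • w.1 = w.1) →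
      ∀ (T : GL (Fin 3) (LocalRing L v)) (a : LocalRing L v), IsUnit a →
        formCongr (conjLocal L (IsCMField.complexConj L) v) T (H.map (algebraMap L (LocalRing L v))) =
          a • (Matrix.of fun i j : Fin 3 => if i.val + j.val + 1 = 3 then (1 : L) else 0).map (algebraMap L (LocalRing L v)) →
        (if ∃ z : LocalRing L v, IsUnit z ∧ a = z * conjLocal L (IsCMField.complexConj L) v z then (1 : ℂ) else -1) = ε v)
    (hεs : ∀ v : HeightOneSpectrum (𝓞 ↥(maximalRealSubfield L)), (∃ w : PlacesOver L v, IsCMField.complexConj L • w.1 ≠ w.1) → ε v = 1) :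
    CMCharIdentityClausesTest L H hH hHd (fun v => (Δ v).constMul (ε v)) mH mG νH νG ξ μω hμu ξloc ↔
      CMCharIdentityClausesTestSigned L H hH hHd Δ mH mG νH νG ξ μω hμu ξloc := by
  refine and_congr ?_ ?_
  · refine forall_congr' fun v => forall_congr' fun hns => forall_congr' fun T => forall_congr' fun a => forall_congr' fun ha =>
      forall_congr' fun h => forall_congr' fun _ => forall_congr' fun _ => forall_congr' fun μZ => forall_congr' fun _ =>
      forall_congr' fun π2 => forall_congr' fun πn => forall_congr' fun _ => forall_congr' fun _ => ?_
    have hsign : (if ∃ z : LocalRing L v, IsUnit z ∧ a = z * conjLocal L (IsCMField.complexConj L) v z then (1 : ℂ) else -1) *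
        (if ∃ z : LocalRing L v, IsUnit z ∧ a = z * conjLocal L (IsCMField.complexConj L) v z then (1 : ℂ) else -1) = 1 := by
      split_ifs <;> norm_num
    dsimp only
    rw [← hεn v hns T a ha h]
    exact cmNonsplitCharIdentityAtTest_constMul_iff_signed L v H (Δ v) (mH v) (mG v) (νG v) (νH v) (ξloc v) hsign _
  · refine forall_congr' fun v => forall_congr' fun hs => ?_
    dsimp only
    rw [hεs v hs, TransferFactorData.constMul_one]

open scoped Classical in
/-- **THE UNSIGNED PACKAGE `Q_CM^{test}` AT THE RESCALED FAMILY IS THE SIGNED PACKAGE `Q_CM^{test,±}` AT `Δ`** (same sign family `ε` as in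
`cmCharIdentityClausesTest_constMul_iff_signed`; `∀ ξ`). [cite: Rogawski1990, §13.1 Prop. 13.1.4 p. 199; §13.3 p. 202; §14.6 p. 242] [cite: LanglandsShelstad1987, §1] -/
theorem cmCharIdentityPackageTest_constMul_iff_signed
    (ε : HeightOneSpectrum (𝓞 ↥(maximalRealSubfield L)) → ℂ)
    (hεn : ∀ v : HeightOneSpectrum (𝓞 ↥(maximalRealSubfield L)), (∀ w : PlacesOver L v, IsCMField.complexConj L • w.1 = w.1) →
      ∀ (T : GL (Fin 3) (LocalRing L v)) (a : LocalRing L v), IsUnit a →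
        formCongr (conjLocal L (IsCMField.complexConj L) v) T (H.map (algebraMap L (LocalRing L v))) =
          a • (Matrix.of fun i j : Fin 3 => if i.val + j.val + 1 = 3 then (1 : L) else 0).map (algebraMap L (LocalRing L v)) →
        (if ∃ z : LocalRing L v, IsUnit z ∧ a = z * conjLocal L (IsCMField.complexConj L) v z then (1 : ℂ) else -1) = ε v)
    (hεs : ∀ v : HeightOneSpectrum (𝓞 ↥(maximalRealSubfield L)), (∃ w : PlacesOver L v, IsCMField.complexConj L • w.1 ≠ w.1) → ε v = 1) :
    CMCharIdentityPackageTest L H hH hHd νH νG μω hμu (fun v => (Δ v).constMul (ε v)) mH mG ↔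
      CMCharIdentityPackageTestSigned L H hH hHd νH νG μω hμu Δ mH mG :=
  forall_congr' fun ξ => cmCharIdentityClausesTest_constMul_iff_signed L H hH hHd Δ mH mG νH νG μω hμu ξ (fun v => ξ.xiLocalChar v) ε hεn hεs

end Clauses

end Literature.NumberTheory.Rogawski1990

end
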